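import Mathlib
import HarnessLib

/-!
# Item `LrcModEntire` (stmt-NavierStokesRegularity-20428), registry twist_split v7 — PEAKLESS IS A TWO-SIDED MAXIMUM PRINCIPLE ON HORIZONTAL PLANES
# (bricks (Q0)/(Q1) of the «ridge quasiconvexity» lever, memo `Cruxes/LrcModEntire/T2B-g14.md` §9)

LEAD of item 20428 ns-poloidal-K2-p3 g14 (`--supports stmt-NavierStokesRegularity-20428 --as helper`).  Every conditional cell of K2 (the (TH) column's `stub_T2b`,
the thick column's `stub_C2a'`/`stub_C2b'`, LINE 20/21's ESC-END / CONVERGENT-WEB / NULL-CONTINUUM) carries the hypothesis **Peakless** VERBATIM — «no island bracket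
`(K, O)` on any horizontal plane, at any time, for either sign of `v₂`» (from the wall ⟨27893⟩ via `…HotLoopsReduction.zero_of_island`).  This file turns that
hypothesis into the tool the cells' provers and disprovers need, CLASS-FREE (the field `v` is arbitrary; only the Peakless binder and continuity on the compact set enter):

* `exists_isMaxOn_diff_of_peakless` — **(Q0) the maximum principle**: for `s < 0`, a height `z₀`, a sign `σ = ±1`, a non-empty compact planar set `D ⊆ {y₂ = z₀}` on
  which `y ↦ v(s,y)₂` is continuous, and an open `U ⊆ ℝ³` whose planar trace `U ∩ {y₂ = z₀}` lies in `D` («the interior»): the maximum of `σ·v₂(s,·)` over `D` is attained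
  at a point of `D \ U` («the boundary»).  Proof: otherwise `K := argmax_D`, `O := U` is an island bracket.
* `exists_isMaxOn_diff_diff_of_peakless` — **(Q1, abstract tube form)**: if moreover a «lateral» part `L ⊆ D` carries values strictly below some value attained in `D`, the
  maximum is attained in `(D \ U) \ L` («on the ends»).  Along a hot arc with an isolating tube this is the RIDGE QUASICONVEXITY of the memo (the cross-section maximum is
  quasiconvex along the arc for all nearby times and heights).
* `not_strictLocalMax_on_plane_of_peakless` — no point is a STRICT local maximum of `σ·v₂(s,·)` restricted to its horizontal plane (take `D` = closed ball ∩ plane,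
  `U` = open ball): `v₂` is saddle-type on every plane at every time.

WHAT THIS IS NOT: not a claim about Navier–Stokes regularity — a reformulation of one hypothesis of the registered research stubs (bears_on LADDER-NS N0, item 20428 / crux 19708;
both OPEN, ⟨27893⟩ OPEN).
-/

noncomputable section

-- the summit and its single sub-problem share the name (CONVENTIONS §1), as in every Theorems file
set_option linter.dupNamespace false

namespace Summit.NavierStokesRegularity.NavierStokesRegularity.Theorems.PoloidalWindowDoorLrcModEntirePeaklessPlanarMaxPrinciple

open Set Filter Topology Metric

variable {v : ℝ → EuclideanSpace ℝ (Fin 3) → EuclideanSpace ℝ (Fin 3)}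

/-- **(Q0) PEAKLESS ⇒ THE PLANAR MAXIMUM PRINCIPLE.**  If `v` admits no island bracket (the Peakless binder of the K2 cells, VERBATIM), then for every time `s < 0`, height
`z₀`, sign `σ = ±1`, non-empty compact planar `D ⊆ {y₂ = z₀}` on which `y ↦ v(s,y)₂` is continuous, and every open `U` with `U ∩ {y₂ = z₀} ⊆ D`, the maximum of `σ·v₂(s,·)` over
`D` is attained on `D \ U`. -/
theorem exists_isMaxOn_diff_of_peakless
    (hpk : ∀ (s z₀ σ M : ℝ) (K O : Set (EuclideanSpace ℝ (Fin 3))), s < 0 →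
      ((σ = 1 ∨ σ = -1) ∧ IsCompact K ∧ K.Nonempty ∧ (∀ y ∈ K, y 2 = z₀ ∧ σ * v s y 2 = M) ∧
        IsOpen O ∧ K ⊆ O ∧ (∀ y ∈ O, y 2 = z₀ → σ * v s y 2 ≤ M) ∧
        (∀ y ∈ O, y 2 = z₀ → σ * v s y 2 = M → y ∈ K)) → False)
    {s : ℝ} (hs : s < 0) {z₀ σ : ℝ} (hσ : σ = 1 ∨ σ = -1)
    {D : Set (EuclideanSpace ℝ (Fin 3))} (hD : IsCompact D) (hDne : D.Nonempty) (hDz : ∀ y ∈ D, y 2 = z₀)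
    (hcont : ContinuousOn (fun y => v s y 2) D)
    {U : Set (EuclideanSpace ℝ (Fin 3))} (hU : IsOpen U) (hUD : ∀ y ∈ U, y 2 = z₀ → y ∈ D) :
    ∃ y ∈ D \ U, ∀ y' ∈ D, σ * v s y' 2 ≤ σ * v s y 2 := by
  -- the function and its maximum over `D`
  set f : EuclideanSpace ℝ (Fin 3) → ℝ := fun y => σ * v s y 2 with hf
  have hfc : ContinuousOn f D := continuousOn_const.mul hcont
  obtain ⟨y₀, hy₀D, hy₀⟩ := hD.exists_isMaxOn hDne hfc
  set M : ℝ := f y₀ with hM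
  have hle : ∀ y' ∈ D, f y' ≤ M := fun y' hy' => hy₀ hy'
  by_contra hcon
  push Not at hcon
  -- every maximiser lies in `U`
  have hmaxU : ∀ y ∈ D, f y = M → y ∈ U := by
    intro y hyD hyM
    by_contra hyU
    obtain ⟨y', hy'D, hlt⟩ := hcon y ⟨hyD, hyU⟩
    exact absurd (hle y' hy'D) (by rw [← hyM]; exact not_le.2 hlt)
  -- the island bracket `(K, U)` with `K := argmax_D f`
  set K : Set (EuclideanSpace ℝ (Fin 3)) := D ∩ f ⁻¹' {M} with hK
  have hKc : IsCompact K := hD.of_isClosed_subset (hfc.preimage_isClosed_of_isClosed hD.isClosed isClosed_singleton) inter_subset_left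
  have hKne : K.Nonempty := ⟨y₀, hy₀D, by simp [hM]⟩
  refine hpk s z₀ σ M K U hs ⟨hσ, hKc, hKne, fun y hy => ⟨hDz y hy.1, by simpa [hK] using hy.2⟩, hU,
    fun y hy => hmaxU y hy.1 (by simpa [hK] using hy.2), fun y hyU hyz => hle y (hUD y hyU hyz), fun y hyU hyz hyM => ?_⟩
  exact ⟨hUD y hyU hyz, by simpa [hK] using hyM⟩

/-- **(Q1) ABSTRACT TUBE FORM — the maximum sits on the ends.**  As (Q0), with a «lateral» part `L ⊆ D` on which `σ·v₂(s,·)` stays strictly below a value attained somewhere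
in `D`: the maximum over `D` is attained in `(D \ U) \ L`.  (For a hot arc with an isolating tube, `L` = the lateral boundary of the tube, and the conclusion for every sub-arc is
the quasiconvexity of the cross-section maximum along the arc — memo T2B-g14 §9 (Q1).) -/
theorem exists_isMaxOn_diff_diff_of_peakless
    (hpk : ∀ (s z₀ σ M : ℝ) (K O : Set (EuclideanSpace ℝ (Fin 3))), s < 0 →
      ((σ = 1 ∨ σ = -1) ∧ IsCompact K ∧ K.Nonempty ∧ (∀ y ∈ K, y 2 = z₀ ∧ σ * v s y 2 = M) ∧
        IsOpen O ∧ K ⊆ O ∧ (∀ y ∈ O, y 2 = z₀ → σ * v s y 2 ≤ M) ∧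
        (∀ y ∈ O, y 2 = z₀ → σ * v s y 2 = M → y ∈ K)) → False)
    {s : ℝ} (hs : s < 0) {z₀ σ : ℝ} (hσ : σ = 1 ∨ σ = -1)
    {D : Set (EuclideanSpace ℝ (Fin 3))} (hD : IsCompact D) (hDne : D.Nonempty) (hDz : ∀ y ∈ D, y 2 = z₀)
    (hcont : ContinuousOn (fun y => v s y 2) D)
    {U : Set (EuclideanSpace ℝ (Fin 3))} (hU : IsOpen U) (hUD : ∀ y ∈ U, y 2 = z₀ → y ∈ D)
    {L : Set (EuclideanSpace ℝ (Fin 3))} (hL : ∃ y₁ ∈ D, ∀ y ∈ L, σ * v s y 2 < σ * v s y₁ 2) :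
    ∃ y ∈ (D \ U) \ L, ∀ y' ∈ D, σ * v s y' 2 ≤ σ * v s y 2 := by
  obtain ⟨y, hy, hmax⟩ := exists_isMaxOn_diff_of_peakless hpk hs hσ hD hDne hDz hcont hU hUD
  obtain ⟨y₁, hy₁D, hy₁⟩ := hL
  refine ⟨y, ⟨hy, fun hyL => ?_⟩, hmax⟩
  exact absurd (hmax y₁ hy₁D) (not_le.2 (hy₁ y hyL))

/-- **NO STRICT PLANE-LOCAL EXTREMUM.**  Under Peakless, no point `y₀` of a slice `s < 0` (with `y ↦ v(s,y)₂` continuous near `y₀`) is a strict local maximum of `σ·v₂(s,·)`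
restricted to its own horizontal plane: there is no `r > 0` with `σv₂(s,y) < σv₂(s,y₀)` for all `y ≠ y₀` of the plane with `dist y y₀ ≤ r`.  (`D` = closed ball ∩ plane,
`U` = open ball in (Q0).)  With both signs: `v₂` is saddle-type on every plane at every time. -/
theorem not_strictLocalMax_on_plane_of_peakless
    (hpk : ∀ (s z₀ σ M : ℝ) (K O : Set (EuclideanSpace ℝ (Fin 3))), s < 0 →
      ((σ = 1 ∨ σ = -1) ∧ IsCompact K ∧ K.Nonempty ∧ (∀ y ∈ K, y 2 = z₀ ∧ σ * v s y 2 = M) ∧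
        IsOpen O ∧ K ⊆ O ∧ (∀ y ∈ O, y 2 = z₀ → σ * v s y 2 ≤ M) ∧
        (∀ y ∈ O, y 2 = z₀ → σ * v s y 2 = M → y ∈ K)) → False)
    {s : ℝ} (hs : s < 0) {σ : ℝ} (hσ : σ = 1 ∨ σ = -1) (y₀ : EuclideanSpace ℝ (Fin 3)) {r : ℝ} (hr : 0 < r)
    (hcont : ContinuousOn (fun y => v s y 2) (closedBall y₀ r))
    (hstrict : ∀ y : EuclideanSpace ℝ (Fin 3), y 2 = y₀ 2 → y ≠ y₀ → dist y y₀ ≤ r → σ * v s y 2 < σ * v s y₀ 2) : False := by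
  set D : Set (EuclideanSpace ℝ (Fin 3)) := closedBall y₀ r ∩ {y | y 2 = y₀ 2} with hDdef
  have hplane : IsClosed {y : EuclideanSpace ℝ (Fin 3) | y 2 = y₀ 2} :=
    isClosed_eq ((EuclideanSpace.proj (𝕜 := ℝ) (2 : Fin 3)).continuous) continuous_const
  have hD : IsCompact D := (isCompact_closedBall y₀ r).inter_right hplane
  have hy₀D : y₀ ∈ D := ⟨mem_closedBall_self hr.le, rfl⟩
  have hDz : ∀ y ∈ D, y 2 = y₀ 2 := fun y hy => hy.2
  have hcD : ContinuousOn (fun y => v s y 2) D := hcont.mono inter_subset_left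
  have hUD : ∀ y ∈ ball y₀ r, y 2 = y₀ 2 → y ∈ D := fun y hy hyz => ⟨ball_subset_closedBall hy, hyz⟩
  obtain ⟨y, ⟨hyD, hyU⟩, hmax⟩ := exists_isMaxOn_diff_of_peakless hpk hs hσ hD ⟨y₀, hy₀D⟩ hDz hcD isOpen_ball hUD
  have hne : y ≠ y₀ := fun h => hyU (by rw [h]; exact mem_ball_self hr)
  have hdist : dist y y₀ ≤ r := mem_closedBall.1 hyD.1
  exact absurd (hmax y₀ hy₀D) (not_le.2 (hstrict y hyD.2 hne hdist))

end Summit.NavierStokesRegularity.NavierStokesRegularity.Theorems.PoloidalWindowDoorLrcModEntirePeaklessPlanarMaxPrinciple
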